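import Summits.ValiantsHypothesis.ValiantsHypothesis.Theorems.BarrierLeverPriorityPeelingLayoutsSmallRank

/-!
# Route BarrierLever — priority peeling for TT: graded configurations with at most three rows

Helper file (`--supports stmt-ValiantsHypothesis-19761`; cell valiant-natproofs, rung V4, 𝒟-side door
(c); prover val-np-p1 g7). Closes NO item. A configuration (`R i : Fin e → Fin nr`, `C j : Fin e → Fin nc`,
`i j : ι`) is GRADED when a literal determines its slot (`R i a = R i' a' → a = a'`, same for columns)
and BINARY when each slot carries at most two row literals and at most two column literals. TT layouts
are graded and binary (slot `a` carries `castAdd h a / natAdd h a`), and so are the children of their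
pair moves — which is what makes the following two steps compose WITHOUT certificates:

* `ppDerivable_config_two` — a graded configuration on a two-element index type with distinct rows
  and distinct columns is PP-derivable (one pair move at a slot where the rows differ, the columns
  split at a slot where they differ, children single rows);
* `ppDerivable_config_three` — a graded binary configuration on a three-element index type with
  pairwise distinct rows and columns is PP-derivable (a slot where the rows split `2 + 1`, a slot
  where the columns split `2 + 1`, matching `Equiv.swap`; the pair child is `ppDerivable_config_two`
  on the subtype, the other child a single row);
* `ppDerivable_layout_r3` — hence every injective TT layout with `r = 3` rows is PP-derivable for
  EVERY `h`, and with `…LayoutsSmallRank` (p473391) every layout with `r ≤ 3`: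
  `ppDerivable_layout_of_r_le_three`, `transversalMinorLayouts_nonsingular_of_r_le_three` (TT's
  conclusion), complementing the `h ≤ 3` rung (`…LayoutsUpToThree`, p478746).

WHAT THIS IS NOT: four rows already need genuine priorities across several literals (the `2 + 2`
versus `1 + 3` splits need not match); nothing on 19761 / TT (19152) in general, on crux
stmt-ValiantsHypothesis-14610, or on VP versus VNP.
-/

-- layout Summits/ValiantsHypothesis/ValiantsHypothesis forces the duplicated namespace component
set_option linter.dupNamespace false

namespace Summit.ValiantsHypothesis.ValiantsHypothesis.Theorems.BarrierLever.PPSmall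

open Summit.ValiantsHypothesis.ValiantsHypothesis.Theorems.BarrierLever.PriorityPeeling

/-! ## 1. Two rows -/

/-- **Two rows (graded configurations).** On a two-element index type, a graded configuration with
distinct rows and distinct columns is PP-derivable. -/
theorem ppDerivable_config_two {nr nc e : ℕ} {ι : Type} [Fintype ι] [DecidableEq ι]
    (R : ι → Fin e → Fin nr) (C : ι → Fin e → Fin nc) (i₀ i₁ : ι) (h01 : i₀ ≠ i₁)
    (hι : ∀ i, i = i₀ ∨ i = i₁)
    (hR : ∀ i i' a a', R i a = R i' a' → a = a') (hC : ∀ j j' c c', C j c = C j' c' → c = c')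
    (hRne : R i₀ ≠ R i₁) (hCne : C i₀ ≠ C i₁) : PPDerivable nr nc ι e R C := by
  obtain ⟨p, hp⟩ := Function.ne_iff.mp hRne
  obtain ⟨q, hq⟩ := Function.ne_iff.mp hCne
  obtain ⟨d, rfl⟩ : ∃ d, e = d + 1 :=
    ⟨e - 1, by cases e with | zero => exact Fin.elim0 p | succ e => omega⟩
  have hi1 : ∀ i, i ≠ i₁ → i = i₀ := fun i hi => (hι i).resolve_right hi
  have hRi : ∀ i, Function.Injective (R i) := fun i a a' h => hR _ _ _ _ h
  have hCi : ∀ j, Function.Injective (C j) := fun j c c' h => hC _ _ _ _ h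
  refine PPDerivable.pair R C (R i₀ p) (R i₁ p) hp (fun i => decide (i = i₁)) (fun _ => p)
    ?_ ?_ {C i₀ q} {C i₁ q} (fun _ => 0) (fun j => decide (j = i₁)) (fun _ => q) ?_ ?_
    (Equiv.refl ι) (fun _ => rfl) ?_ ?_
  · intro i
    by_cases hi : i = i₁
    · subst hi; simp
    · rw [hi1 i hi]; simp [h01]
  · intro i a ha
    exact ⟨fun h => ha (hR _ _ _ _ h), fun h => ha (hR _ _ _ _ h)⟩
  · intro j hj
    have hj' : j = i₀ := hi1 j (by simpa using hj)
    subst hj'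
    refine ⟨Finset.mem_singleton_self _, fun q' hq' hne => ?_⟩
    exact absurd (hC _ _ _ _ (Finset.mem_singleton.mp hq')) hne
  · intro j hj
    have hj' : j = i₁ := by simpa using hj
    subst hj'
    refine ⟨fun q' hq' => ?_, Finset.mem_singleton_self _, fun q' hq' hne => ?_⟩
    · have h1 := Finset.mem_singleton.mp hq'
      have h2 := hC _ _ _ _ h1
      subst h2
      exact hq h1.symm
    · exact absurd (hC _ _ _ _ (Finset.mem_singleton.mp hq')) hne
  · refine PPDerivable.single _ _ ⟨i₀, by simp [h01]⟩ (fun i => ?_) ?_ ?_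
    · apply Subtype.ext
      exact hi1 i.1 (by simpa using i.2)
    · exact (hRi i₀).comp Fin.succAbove_right_injective
    · exact (hCi i₀).comp Fin.succAbove_right_injective
  · refine PPDerivable.single _ _ ⟨i₁, by simp⟩ (fun i => ?_) ?_ ?_
    · apply Subtype.ext
      simpa using i.2
    · exact (hRi i₁).comp Fin.succAbove_right_injective
    · exact (hCi i₁).comp Fin.succAbove_right_injective

/-! ## 2. Three rows -/

/-- Three rows, with the roles fixed: `s` is the row that is alone at slot `p` (`R t₁ p = R t₂ p ≠ R s p`)
and `s'` the column that is alone at slot `q`. -/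
theorem ppDerivable_config_three_core {nr nc e : ℕ} {ι : Type} [Fintype ι] [DecidableEq ι]
    (R : ι → Fin e → Fin nr) (C : ι → Fin e → Fin nc)
    (hR : ∀ i i' a a', R i a = R i' a' → a = a') (hC : ∀ j j' c c', C j c = C j' c' → c = c')
    (hRinj : ∀ i i', R i = R i' → i = i') (hCinj : ∀ j j', C j = C j' → j = j')
    (s t₁ t₂ : ι) (hst₁ : s ≠ t₁) (hst₂ : s ≠ t₂) (ht : t₁ ≠ t₂) (hι : ∀ i, i = s ∨ i = t₁ ∨ i = t₂)
    (p : Fin e) (hpt : R t₁ p = R t₂ p) (hps : R s p ≠ R t₁ p)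
    (s' t₁' t₂' : ι) (hst₁' : s' ≠ t₁') (hst₂' : s' ≠ t₂') (hι' : ∀ j, j = s' ∨ j = t₁' ∨ j = t₂')
    (q : Fin e) (hqt : C t₁' q = C t₂' q) (hqs : C s' q ≠ C t₁' q) :
    PPDerivable nr nc ι e R C := by
  obtain ⟨d, rfl⟩ : ∃ d, e = d + 1 :=
    ⟨e - 1, by cases e with | zero => exact Fin.elim0 p | succ e => omega⟩
  -- literals at slot p off `s` are the pair literal; at slot q off `s'` likewise
  have hRp : ∀ i, i ≠ s → R i p = R t₁ p := by
    intro i hi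
    rcases hι i with h | h | h
    · exact absurd h hi
    · rw [h]
    · rw [h, hpt]
  have hCq : ∀ j, j ≠ s' → C j q = C t₁' q := by
    intro j hj
    rcases hι' j with h | h | h
    · exact absurd h hj
    · rw [h]
    · rw [h, hqt]
  have hRi : ∀ i, Function.Injective (R i) := fun i a a' h => hR _ _ _ _ h
  have hCi : ∀ j, Function.Injective (C j) := fun j c c' h => hC _ _ _ _ h
  -- the matching: swap the two singletons
  have hf : ∀ i, decide (i = s) = decide (Equiv.swap s s' i = s') := by
    intro i
    by_cases his : i = s
    · subst his
      simp [Equiv.swap_apply_left]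
    · by_cases his' : i = s'
      · subst his'
        rw [Equiv.swap_apply_right]
        simp [his, Ne.symm his]
      · rw [Equiv.swap_apply_of_ne_of_ne his his']
        simp [his, his']
  refine PPDerivable.pair R C (R t₁ p) (R s p) (Ne.symm hps) (fun i => decide (i = s)) (fun _ => p)
    ?_ ?_ {C t₁' q} {C s' q} (fun _ => 0) (fun j => decide (j = s')) (fun _ => q) ?_ ?_
    (Equiv.swap s s') hf ?_ ?_
  · intro i
    by_cases hi : i = s
    · subst hi; simp
    · simp [hi, hRp i hi]
  · intro i a ha
    exact ⟨fun h => ha (hR _ _ _ _ h), fun h => ha (hR _ _ _ _ h)⟩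
  · intro j hj
    have hj' : j ≠ s' := by simpa using hj
    refine ⟨by rw [hCq j hj']; exact Finset.mem_singleton_self _, fun q' hq' hne => ?_⟩
    exact absurd (hC _ _ _ _ (Finset.mem_singleton.mp hq')) hne
  · intro j hj
    have hj' : j = s' := by simpa using hj
    subst hj'
    refine ⟨fun q' hq' => ?_, Finset.mem_singleton_self _, fun q' hq' hne => ?_⟩
    · have h1 := Finset.mem_singleton.mp hq'
      have h2 := hC _ _ _ _ h1
      subst h2
      exact hqs h1
    · exact absurd (hC _ _ _ _ (Finset.mem_singleton.mp hq')) hne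
  · -- the pair child {t₁, t₂}
    have hmem : ∀ x : {x : ι // decide (x = s) = false}, x.1 = t₁ ∨ x.1 = t₂ := by
      intro x
      have hx : x.1 ≠ s := by simpa using x.2
      rcases hι x.1 with h | h | h
      · exact absurd h hx
      · exact Or.inl h
      · exact Or.inr h
    refine ppDerivable_config_two _ _ ⟨t₁, by simp [Ne.symm hst₁]⟩ ⟨t₂, by simp [Ne.symm hst₂]⟩
      (fun h => ht (congrArg Subtype.val h)) (fun x => ?_) ?_ ?_ ?_ ?_
    · rcases hmem x with h | h
      · exact Or.inl (Subtype.ext h)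
      · exact Or.inr (Subtype.ext h)
    · intro i i' a a' h
      exact Fin.succAbove_right_injective (hR _ _ _ _ h)
    · intro j j' c c' h
      exact Fin.succAbove_right_injective (hC _ _ _ _ h)
    · -- rows t₁, t₂ differ away from p
      intro h
      apply ht
      apply hRinj
      funext a
      by_cases ha : a = p
      · subst ha; exact hpt
      · obtain ⟨a', rfl⟩ := Fin.exists_succAbove_eq ha
        exact congrFun h a'
    · -- columns swap t₁, swap t₂ differ away from q
      intro h
      have hne : Equiv.swap s s' t₁ ≠ Equiv.swap s s' t₂ :=
        fun e => ht ((Equiv.swap s s').injective e)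
      have h1 : Equiv.swap s s' t₁ ≠ s' := by
        have := hf t₁; simp [Ne.symm hst₁] at this; exact this
      have h2 : Equiv.swap s s' t₂ ≠ s' := by
        have := hf t₂; simp [Ne.symm hst₂] at this; exact this
      apply hne
      apply hCinj
      funext c
      by_cases hc : c = q
      · subst hc
        rw [hCq _ h1, hCq _ h2]
      · obtain ⟨c', rfl⟩ := Fin.exists_succAbove_eq hc
        exact congrFun h c'
  · -- the single child {s}
    refine PPDerivable.single _ _ ⟨s, by simp⟩ (fun i => ?_) ?_ ?_
    · apply Subtype.ext
      simpa using i.2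
    · exact (hRi s).comp Fin.succAbove_right_injective
    · exact (hCi (Equiv.swap s s' s)).comp Fin.succAbove_right_injective

/-- **Three rows (graded binary configurations).** On a three-element index type, a graded
configuration in which every slot carries at most two row literals and at most two column literals,
with pairwise distinct rows and pairwise distinct columns, is PP-derivable. -/
theorem ppDerivable_config_three {nr nc e : ℕ} {ι : Type} [Fintype ι] [DecidableEq ι]
    (R : ι → Fin e → Fin nr) (C : ι → Fin e → Fin nc) (i₀ i₁ i₂ : ι) (h01 : i₀ ≠ i₁)
    (h02 : i₀ ≠ i₂) (h12 : i₁ ≠ i₂) (hι : ∀ i, i = i₀ ∨ i = i₁ ∨ i = i₂)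
    (hR : ∀ i i' a a', R i a = R i' a' → a = a') (hC : ∀ j j' c c', C j c = C j' c' → c = c')
    (hR2 : ∀ a i i' i'', R i a ≠ R i' a → R i'' a = R i a ∨ R i'' a = R i' a)
    (hC2 : ∀ c j j' j'', C j c ≠ C j' c → C j'' c = C j c ∨ C j'' c = C j' c)
    (hRinj : ∀ i i', R i = R i' → i = i') (hCinj : ∀ j j', C j = C j' → j = j') :
    PPDerivable nr nc ι e R C := by
  obtain ⟨p, hp⟩ := Function.ne_iff.mp (show R i₀ ≠ R i₁ from fun h => h01 (hRinj _ _ h))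
  obtain ⟨q, hq⟩ := Function.ne_iff.mp (show C i₀ ≠ C i₁ from fun h => h01 (hCinj _ _ h))
  -- row roles: the singleton `s` and the pair `t₁, t₂` at slot p
  have rows : ∃ s t₁ t₂ : ι, s ≠ t₁ ∧ s ≠ t₂ ∧ t₁ ≠ t₂ ∧ (∀ i, i = s ∨ i = t₁ ∨ i = t₂) ∧
      R t₁ p = R t₂ p ∧ R s p ≠ R t₁ p := by
    rcases hR2 p i₀ i₁ i₂ hp with h | h
    · exact ⟨i₁, i₀, i₂, Ne.symm h01, h12, h02, fun i => by rcases hι i with e | e | e <;> simp [e],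
        h.symm, Ne.symm hp⟩
    · exact ⟨i₀, i₁, i₂, h01, h02, h12, hι, h.symm, hp⟩
  have cols : ∃ s t₁ t₂ : ι, s ≠ t₁ ∧ s ≠ t₂ ∧ t₁ ≠ t₂ ∧ (∀ i, i = s ∨ i = t₁ ∨ i = t₂) ∧
      C t₁ q = C t₂ q ∧ C s q ≠ C t₁ q := by
    rcases hC2 q i₀ i₁ i₂ hq with h | h
    · exact ⟨i₁, i₀, i₂, Ne.symm h01, h12, h02, fun i => by rcases hι i with e | e | e <;> simp [e],
        h.symm, Ne.symm hq⟩
    · exact ⟨i₀, i₁, i₂, h01, h02, h12, hι, h.symm, hq⟩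
  obtain ⟨s, t₁, t₂, hst₁, hst₂, ht, hιr, hpt, hps⟩ := rows
  obtain ⟨s', t₁', t₂', hst₁', hst₂', -, hιc, hqt, hqs⟩ := cols
  exact ppDerivable_config_three_core R C hR hC hRinj hCinj s t₁ t₂ hst₁ hst₂ ht hιr p hpt hps
    s' t₁' t₂' hst₁' hst₂' hιc q hqt hqs

/-! ## 3. TT layouts with three rows, every `h` -/

/-- TT row literals determine their coordinate. -/
theorem ttRow_graded (h : ℕ) (s t : Finset (Fin h)) (a a' : Fin h)
    (e : (if a ∈ s then Fin.castAdd h a else Fin.natAdd h a) =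
      (if a' ∈ t then Fin.castAdd h a' else Fin.natAdd h a')) : a = a' := by
  have hv := congrArg Fin.val e
  apply Fin.ext
  by_cases h1 : a ∈ s <;> by_cases h2 : a' ∈ t <;>
    simp only [h1, h2, if_true, if_false, Fin.val_castAdd, Fin.val_natAdd] at hv <;> omega

/-- TT column literals determine their coordinate. -/
theorem ttCol_graded (h : ℕ) (s t : Finset (Fin h)) (c c' : Fin h)
    (e : (if c ∈ s then Fin.natAdd h c else Fin.castAdd h c) =
      (if c' ∈ t then Fin.natAdd h c' else Fin.castAdd h c')) : c = c' := by
  have hv := congrArg Fin.val e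
  apply Fin.ext
  by_cases h1 : c ∈ s <;> by_cases h2 : c' ∈ t <;>
    simp only [h1, h2, if_true, if_false, Fin.val_castAdd, Fin.val_natAdd] at hv <;> omega

/-- **Every injective TT layout with three rows is PP-derivable, for every `h`.** -/
theorem ppDerivable_layout_r3 (h : ℕ) (u w : Fin 3 → Finset (Fin h)) (hu : Function.Injective u)
    (hw : Function.Injective w) :
    PPDerivable (h + h) (h + h) (Fin 3) h
      (fun i a => if a ∈ u i then Fin.castAdd h a else Fin.natAdd h a)
      (fun j c => if c ∈ w j then Fin.natAdd h c else Fin.castAdd h c) := by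
  refine ppDerivable_config_three _ _ 0 1 2 (by decide) (by decide) (by decide)
    (fun i => by fin_cases i <;> simp) (fun i i' a a' e => ttRow_graded h _ _ a a' e)
    (fun j j' c c' e => ttCol_graded h _ _ c c' e) (fun a i i' i'' hne => ?_)
    (fun c j j' j'' hne => ?_) (fun i i' e => hu ?_) (fun j j' e => hw ?_)
  · -- two row literals per slot
    by_cases h1 : a ∈ u i <;> by_cases h2 : a ∈ u i' <;> by_cases h3 : a ∈ u i'' <;>
      simp_all
  · by_cases h1 : c ∈ w j <;> by_cases h2 : c ∈ w j' <;> by_cases h3 : c ∈ w j'' <;>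
      simp_all
  · ext a
    exact mem_iff_of_ttRow_eq h (u i) (u i') a (congrFun e a)
  · ext c
    exact mem_iff_of_ttCol_eq h (w j) (w j') c (congrFun e c)

/-- **Every injective TT layout with `r ≤ 3` rows is PP-derivable, for every `h`.** -/
theorem ppDerivable_layout_of_r_le_three (h r : ℕ) (hr : r ≤ 3) (u w : Fin r → Finset (Fin h))
    (hu : Function.Injective u) (hw : Function.Injective w) :
    PPDerivable (h + h) (h + h) (Fin r) h
      (fun i a => if a ∈ u i then Fin.castAdd h a else Fin.natAdd h a)
      (fun j c => if c ∈ w j then Fin.natAdd h c else Fin.castAdd h c) := by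
  interval_cases r
  · exact ppDerivable_layout_r0 h u w
  · exact ppDerivable_layout_r1 h u w
  · exact ppDerivable_layout_r2 h u w hu hw
  · exact ppDerivable_layout_r3 h u w hu hw

/-- **TT (item 19152) for at most three rows, every `h`**: the conclusion of
`TransversalMinorLayoutsNonsingular` verbatim for every injective layout with `r ≤ 3`. -/
theorem transversalMinorLayouts_nonsingular_of_r_le_three (h r : ℕ) (hr : r ≤ 3)
    (u w : Fin r → Finset (Fin h)) (hu : Function.Injective u) (hw : Function.Injective w) :
    ∃ H : Matrix (Fin (h + h)) (Fin (h + h)) ℂ, (Matrix.of fun i j : Fin r =>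
      (H.submatrix (fun a : Fin h => if a ∈ u i then Fin.castAdd h a else Fin.natAdd h a)
        (fun c : Fin h => if c ∈ w j then Fin.natAdd h c else Fin.castAdd h c)).det).det ≠ 0 :=
  alive_of_ppDerivable (ppDerivable_layout_of_r_le_three h r hr u w hu hw)

end Summit.ValiantsHypothesis.ValiantsHypothesis.Theorems.BarrierLever.PPSmall
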